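import Summits.QuantumFields.YangMills.Theorems.IR.Negative.TypOnsetFloorPoly.Poly
import Summits.QuantumFields.YangMills.Theorems.IR.Negative.HairpinStokes
import Literature.MathematicalPhysics.QuantumFieldTheory.PinnedOneLinkLaplaceWords
import Literature.MathematicalPhysics.QuantumFieldTheory.LatticeGaugeDobrushinPoincare

/-!
# Crux `IR` (stmt-QuantumFields-19354) — the POLYNOMIAL ROW FLOOR `b⋆_T(β) ≥ c·(β / log β)^{1/7}` for EVERY compact gauge group,
# part 3/10: Frobenius bounds, the annealed loop-freezing rate, §4c Frobenius trace and clip algebra (sections `Frobenius`, `FreezeAssembly`, `FrobeniusTrace`, `ClipAlgebra`)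

Re-homed VERBATIM (statements, proofs, names; namespace `…Cruxes.IR.CruxIdea2g7` ↦ `…Cruxes.IR.RowFloorPoly`) from the crux
workfile `Cruxes/IR/CruxIdea2RowFloorPoly.lean` rev 14 (sha16 742d7312ea0b5c70; author `ym-cruxidea-19354-2` GEN 7; kernel certificate
`Cruxes/IR/CruxIdea2RowFloorPolyCert.lean` rev 1, sha16 59d3cfe64fab9c7c, gate-elaborated stub-free) per owner R114 (2) (landing seat:
the `ym-19354-disprove-1` lineage, g9), split by its sections into ten ≤ 400-line modules chained by import; the module docstring of
record (history, theorem map, honest framing) is in the headline module `Theorems/IR/Negative/TypOnsetFloorPoly.lean` (part 10/10).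
Negative knowledge for stmt-QuantumFields-19354 (`--supports`; closes no stub); not mixing, not a mass gap, nothing about Clay.
-/

set_option autoImplicit false

noncomputable section

open MeasureTheory Filter Topology
open Literature.MathematicalPhysics.QuantumLattice
open Literature.Probability.LatticeModels
open Summit.QuantumFields.YangMills.Cruxes.IR.Tempered (cellEdges windowCells regionEdges)
open Summit.QuantumFields.YangMills.Cruxes.IR.ShellTempered (windowCellsPlus)
open Summit.QuantumFields.YangMills.Cruxes.IR.OnsetFormats (TypShellCond shellCount)
open Summit.QuantumFields.YangMills.Cruxes.IR.FixedMesh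
open Summit.QuantumFields.YangMills.Cruxes.IR.FixedMeshAllG
open Summit.QuantumFields.YangMills.Theorems.FemtoCurvatureTwoPoint.DoublingOfRV (norm_rho_mul_sub_one_le norm_rho_inv_sub_one)
open Summit.QuantumFields.YangMills.Cruxes.IR.HairpinStokes (norm_map_conj_sub_one sub_re_trace_eq_norm_sq)
open Literature.MathematicalPhysics.QuantumFieldTheory (abs_re_trace_le_sqrt_mul re_trace_map_inv)

namespace Summit.QuantumFields.YangMills.Cruxes.IR.RowFloorPoly

section Frobenius

open scoped Matrix Matrix.Norms.Frobenius

variable {G : Type} [Group G] {N : ℕ} (ρ : G →* Matrix (Fin N) (Fin N) ℂ)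

/-- **Quantitative strip Stokes**: `‖ρ(strip) − 1‖ ≤ Σ_{t<A} ‖ρ(U_{(t,M)}) − 1‖`. -/
theorem norm_stripHol_sub_one_le (hρu : ∀ g, ρ g ∈ Matrix.unitaryGroup (Fin N) ℂ) (U : LGConfig 4 G)
    (M : ℕ) : ∀ A : ℕ,
    ‖ρ (stripHol U M A) - 1‖ ≤ ∑ t ∈ Finset.range A, ‖ρ (plaq U t M) - 1‖ := by
  intro A
  induction A with
  | zero => simp
  | succ A ih =>
    rw [stripHol_succ, Finset.sum_range_succ]
    refine (norm_rho_mul_sub_one_le ρ hρu _ _).trans ?_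
    rw [norm_map_conj_sub_one ρ hρu]
    linarith

/-- **Quantitative planar Stokes**: `‖ρ(∂ rectangle) − 1‖ ≤ Σ_{s<M} Σ_{t<A} ‖ρ(U_{(t,s)}) − 1‖`. -/
theorem norm_rectHol_sub_one_le (hρu : ∀ g, ρ g ∈ Matrix.unitaryGroup (Fin N) ℂ) (U : LGConfig 4 G)
    (A : ℕ) : ∀ M : ℕ,
    ‖ρ (rectHol U A M) - 1‖ ≤ ∑ s ∈ Finset.range M, ∑ t ∈ Finset.range A, ‖ρ (plaq U t s) - 1‖ := by
  intro M
  induction M with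
  | zero => simp
  | succ M ih =>
    rw [rectHol_succ, Finset.sum_range_succ]
    refine (norm_rho_mul_sub_one_le ρ hρu _ _).trans ?_
    rw [norm_map_conj_sub_one ρ hρu]
    have := norm_stripHol_sub_one_le ρ hρu U M A
    linarith

/-- **DETERMINISTIC STOKES INEQUALITY (instance-free statement).**  For unitary `ρ`, `N ≥ 1`, `b ≥ 1`:
`1 − W_{b,m}(U) ≤ ((b+1) m / N) · Σ_{s<m} Σ_{t<b+1} (N − Re tr ρ(U_{(t,s)}))` — the rectangle loop deficit is
controlled by the plaquette costs of its planar spanning surface, configuration by configuration. -/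
theorem one_sub_loopObs_le (hρu : ∀ g, ρ g ∈ Matrix.unitaryGroup (Fin N) ℂ) (hN : 1 ≤ N) {b : ℕ}
    (hb : 1 ≤ b) (m : ℕ) (U : LGConfig 4 G) :
    1 - loopObs ρ b m U ≤ ((b + 1 : ℕ) * m / N : ℝ) *
      ∑ s ∈ Finset.range m, ∑ t ∈ Finset.range (b + 1), ((N : ℝ) - (ρ (plaq U t s)).trace.re) := by
  have hN0 : (0 : ℝ) < N := by exact_mod_cast hN
  have hloop : loopObs ρ b m U = (ρ (col b U * staple b m U)).trace.re / N := by
    simp [loopObs, chargedTest, Complex.div_natCast_re]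
  -- the loop deficit as a norm square
  have hdef : 1 - loopObs ρ b m U = ‖ρ (col b U * staple b m U) - 1‖ ^ 2 / 2 / N := by
    rw [hloop, ← sub_re_trace_eq_norm_sq ρ hρu]
    field_simp
  -- Stokes bound on the norm
  have hconj : ‖ρ (col b U * staple b m U) - 1‖ = ‖ρ (rectHol U (b + 1) m) - 1‖ := by
    rw [col_mul_staple_eq_conj_rectHol hb m U]
    have := norm_map_conj_sub_one ρ hρu (U (site2 0 0, 0))⁻¹ (rectHol U (b + 1) m)
    rwa [inv_inv] at this
  set D : ℝ := ∑ s ∈ Finset.range m, ∑ t ∈ Finset.range (b + 1), ‖ρ (plaq U t s) - 1‖ with hD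
  have hnorm : ‖ρ (col b U * staple b m U) - 1‖ ≤ D := hconj ▸ norm_rectHol_sub_one_le ρ hρu U (b + 1) m
  -- Cauchy–Schwarz over the surface
  have hCS : D ^ 2 ≤ ((b + 1 : ℕ) * m : ℝ) *
      ∑ s ∈ Finset.range m, ∑ t ∈ Finset.range (b + 1), ‖ρ (plaq U t s) - 1‖ ^ 2 := by
    have h := sq_sum_le_card_mul_sum_sq (s := Finset.range m ×ˢ Finset.range (b + 1))
      (f := fun p : ℕ × ℕ => ‖ρ (plaq U p.2 p.1) - 1‖)
    rw [Finset.sum_product, Finset.sum_product, Finset.card_product, Finset.card_range,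
      Finset.card_range] at h
    push_cast at h ⊢
    rw [hD]
    linarith
  have hsq : ∑ s ∈ Finset.range m, ∑ t ∈ Finset.range (b + 1), ‖ρ (plaq U t s) - 1‖ ^ 2 =
      2 * ∑ s ∈ Finset.range m, ∑ t ∈ Finset.range (b + 1), ((N : ℝ) - (ρ (plaq U t s)).trace.re) := by
    rw [Finset.mul_sum]
    refine Finset.sum_congr rfl fun s _ => ?_
    rw [Finset.mul_sum]
    refine Finset.sum_congr rfl fun t _ => ?_
    rw [sub_re_trace_eq_norm_sq ρ hρu]
    ring
  rw [hdef]
  have h0 : 0 ≤ ‖ρ (col b U * staple b m U) - 1‖ := norm_nonneg _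
  have h1 : ‖ρ (col b U * staple b m U) - 1‖ ^ 2 ≤ D ^ 2 := pow_le_pow_left₀ h0 hnorm 2
  rw [hsq] at hCS
  have h2 : ‖ρ (col b U * staple b m U) - 1‖ ^ 2 / 2 / N ≤ D ^ 2 / 2 / N := by
    gcongr
  refine h2.trans ?_
  rw [div_div, div_le_iff₀ (by positivity)]
  have hN1 : (N : ℝ) ≠ 0 := hN0.ne'
  calc D ^ 2 ≤ _ := hCS
    _ = _ := by field_simp

end Frobenius

section FreezeAssembly

open Literature.MathematicalPhysics.QuantumFieldTheory (wilsonMeasure GaugeConfig isProbabilityMeasure_wilsonMeasure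
  LatticeRep plaquetteCost Plaquette)
open Summit.QuantumFields.YangMills.Theorems.TunedSequenceExists.Negative.Freezing (plaquetteHolonomyZd_torusLift')

variable {G : Type} [Group G] [TopologicalSpace G] [IsTopologicalGroup G] [CompactSpace G]
  [SecondCountableTopology G] [MeasurableSpace G] [BorelSpace G]
  {N : ℕ} (ρ : G →* Matrix (Fin N) (Fin N) ℂ)

/-- The `(0,1)` torus plaquette under the base point `site2 t s`. -/
def torusPlaq (L : ℕ) (t s : ℤ) : Plaquette 4 L :=
  (Torus.proj L (site2 t s), ⟨((0 : Fin 4), (1 : Fin 4)), by decide⟩)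

omit [TopologicalSpace G] [IsTopologicalGroup G] [CompactSpace G] [SecondCountableTopology G] [MeasurableSpace G]
  [BorelSpace G] in
/-- The lifted plaquette cost IS the torus plaquette cost. -/
theorem plaqCost_torusLift (L : ℕ) (V : GaugeConfig 4 L G) (t s : ℤ) :
    (N : ℝ) - (ρ (plaq (torusLift L V) t s)).trace.re = plaquetteCost ρ V (torusPlaq L t s) := by
  simp only [plaq, plaquetteHolonomyZd_torusLift', plaquetteCost, torusPlaq]

/-- **The ANNEALED MEAN of the loop deficit** on the odd torus: `1 − E[W_{b,m} ∘ lift] ≤ ((b+1)m)²/N · K(1+log β)/β`. -/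
theorem one_sub_integral_loopObs_le (hρ : Continuous ρ) (hρi : Function.Injective ρ)
    (hρu : ∀ g, ρ g ∈ Matrix.unitaryGroup (Fin N) ℂ) (hN : 1 ≤ N) :
    ∃ K : ℝ, 0 ≤ K ∧ ∀ (L : ℕ), 1 ≤ L → ∀ β : ℝ, 1 ≤ β → ∀ {b : ℕ}, 1 ≤ b → ∀ m : ℕ,
      1 - ∫ V, loopObs ρ b m (torusLift (2 * L + 1) V) ∂(wilsonMeasure (d := 4) (L := 2 * L + 1) ρ β) ≤
        ((b + 1 : ℕ) * m : ℝ) ^ 2 / N * (K * (1 + Real.log β) / β) := by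
  set r : LatticeRep G := ⟨N, ρ, hρ, hρi, hρu⟩ with hr
  obtain ⟨K, hK0, hmom⟩ := AfOnset.exists_plaquetteCost_moments_le r
  refine ⟨K, hK0, fun L hL β hβ b hb m => ?_⟩
  set S : ℕ := 2 * L + 1 with hS
  set μ := wilsonMeasure (d := 4) (L := S) ρ β with hμ
  haveI : IsProbabilityMeasure μ := isProbabilityMeasure_wilsonMeasure ρ hρ β
  have hN0 : (0 : ℝ) < N := by exact_mod_cast hN
  -- the summands
  set φ : ℤ → ℤ → GaugeConfig 4 S G → ℝ := fun t s V => (N : ℝ) - (ρ (plaq (torusLift S V) t s)).trace.re with hφ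
  have hφcont : ∀ t s, Continuous (φ t s) := by
    intro t s
    simp only [hφ, plaq]
    exact continuous_const.sub ((continuous_plaquetteObs ρ hρ (site2 t s) 0 1).comp (continuous_torusLift S))
  have hφint : ∀ t s, Integrable (φ t s) μ := by
    intro t s
    refine Integrable.of_bound (hφcont t s).measurable.aestronglyMeasurable (2 * N) (ae_of_all _ fun V => ?_)
    have h := abs_le.1 (abs_plaquetteObs_le_holds ρ hρu (site2 t s) 0 1 (torusLift S V))
    simp only [hφ, plaq, Real.norm_eq_abs]
    rw [abs_le]
    simp only [plaquetteObs] at h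
    constructor <;> linarith [h.1, h.2]
  have hφmean : ∀ t s, ∫ V, φ t s V ∂μ ≤ K * (1 + Real.log β) / β := by
    intro t s
    have h := (hmom L hL β hβ (torusPlaq S t s)).1
    have heq : ∫ V, φ t s V ∂μ = ∫ V, plaquetteCost r.ρ V (torusPlaq S t s) ∂μ :=
      integral_congr_ae (ae_of_all _ fun V => plaqCost_torusLift ρ S V t s)
    rw [heq]
    exact h
  -- the loop observable
  have hWint : Integrable (fun V : GaugeConfig 4 S G => loopObs ρ b m (torusLift S V)) μ := by
    refine Integrable.of_bound
      (((continuous_loopObs ρ hρ b m).comp (continuous_torusLift S)).measurable.aestronglyMeasurable) 1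
      (ae_of_all _ fun V => ?_)
    rw [Real.norm_eq_abs]
    exact abs_loopObs_le ρ hρu b m _
  -- pointwise Stokes
  set A : ℝ := ((b + 1 : ℕ) * m : ℝ) with hA
  have hpt : ∀ V : GaugeConfig 4 S G, 1 - loopObs ρ b m (torusLift S V) ≤
      A / N * ∑ s ∈ Finset.range m, ∑ t ∈ Finset.range (b + 1), φ t s V := by
    intro V
    have h := one_sub_loopObs_le ρ hρu hN hb m (torusLift S V)
    simpa [hφ, hA] using h
  -- integrate
  have hsumint : Integrable (fun V => A / N * ∑ s ∈ Finset.range m, ∑ t ∈ Finset.range (b + 1), φ t s V) μ := by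
    refine Integrable.const_mul ?_ _
    refine integrable_finsetSum (Finset.range m) fun s _ => ?_
    exact integrable_finsetSum (Finset.range (b + 1)) fun t _ => hφint t s
  have h1 : 1 - ∫ V, loopObs ρ b m (torusLift S V) ∂μ = ∫ V, (1 - loopObs ρ b m (torusLift S V)) ∂μ := by
    rw [integral_sub (integrable_const _) hWint, integral_const, smul_eq_mul, mul_one]
    simp
  rw [h1]
  calc ∫ V, (1 - loopObs ρ b m (torusLift S V)) ∂μ
      ≤ ∫ V, A / N * ∑ s ∈ Finset.range m, ∑ t ∈ Finset.range (b + 1), φ t s V ∂μ :=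
        integral_mono ((integrable_const _).sub hWint) hsumint hpt
    _ = A / N * ∑ s ∈ Finset.range m, ∑ t ∈ Finset.range (b + 1), ∫ V, φ t s V ∂μ := by
        rw [integral_const_mul]
        congr 1
        rw [integral_finsetSum (Finset.range m) fun s _ =>
          integrable_finsetSum (Finset.range (b + 1)) fun t _ => hφint t s]
        refine Finset.sum_congr rfl fun s _ => ?_
        rw [integral_finsetSum (Finset.range (b + 1)) fun t _ => hφint t s]
    _ ≤ A / N * ∑ s ∈ Finset.range m, ∑ t ∈ Finset.range (b + 1), K * (1 + Real.log β) / β := by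
        gcongr with s _ t _
        exact hφmean t s
    _ = A ^ 2 / N * (K * (1 + Real.log β) / β) := by
        rw [Finset.sum_const, Finset.sum_const, Finset.card_range, Finset.card_range, nsmul_eq_mul, nsmul_eq_mul,
          hA]
        push_cast
        ring

end FreezeAssembly

/-! ## §4c PROVED pieces of the F_poly plan: step (3) (pointwise algebra of the clipped twisted test) and the
## energy–entropy tail for the Yang–Mills DLR kernel (step (4), measure side)

`clip_re_trace_twisted_le`: for unitary `ρ`, `r = Re χ_ρ(k₀)/N < 1`, EVERY `H` and conjugator `g`,
`clip r (Re tr ρ(H · g k₀⁻¹ g⁻¹)/N) ≤ −1 + (2/((1−r)√N)) ‖ρ(H) − 1‖_F` (so the twisted clipped test exceeds `−1` only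
through the Frobenius defect of the physical rectangle holonomy, which §4b's Stokes bounds by plaquette defects);
`ymSpecification_tail_le`: `γ_Λ(·|η){a < A} ≤ e^{−β(a−s)}/μ_{Λ,η}{A ≤ s}` for the kernel `ymSpecification ρ β Λ η`
(definitionally the tilt of glued product Haar `μ_{Λ,η}` by `−β A`, `A = wilsonBoundaryAction ρ Λ ≥ 0`). -/

section FrobeniusTrace

open scoped Matrix Matrix.Norms.Frobenius

variable {N : ℕ}

end FrobeniusTrace

section ClipAlgebra

open scoped Matrix Matrix.Norms.Frobenius

variable {G : Type} [Group G] {N : ℕ} (ρ : G →* Matrix (Fin N) (Fin N) ℂ)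

/-- **The loop-times-conjugate-twist deviation**: `|Re tr ρ(H · g k₀⁻¹ g⁻¹)/N − Re tr ρ(k₀)/N| ≤ ‖ρ(H) − 1‖_F / √N`. -/
theorem abs_re_trace_mul_conj_sub_le (hρu : ∀ g, ρ g ∈ Matrix.unitaryGroup (Fin N) ℂ) (hN : 1 ≤ N)
    (H g k₀ : G) :
    |(ρ (H * (g * k₀⁻¹ * g⁻¹))).trace.re / N - (ρ k₀).trace.re / N| ≤ ‖ρ H - 1‖ / Real.sqrt N := by
  have hN0 : (0 : ℝ) < N := by exact_mod_cast hN
  have hsq : 0 < Real.sqrt N := Real.sqrt_pos.2 hN0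
  set k' : G := g * k₀⁻¹ * g⁻¹ with hk'
  have hr : (ρ k').trace.re = (ρ k₀).trace.re := by
    rw [hk', map_mul, map_mul, Matrix.trace_mul_cycle, ← map_mul, inv_mul_cancel, map_one, one_mul, re_trace_map_inv ρ hρu]
  have hdiff : (ρ (H * k')).trace.re - (ρ k').trace.re = ((ρ H - 1) * ρ k').trace.re := by
    rw [map_mul, sub_mul, one_mul, Matrix.trace_sub, Complex.sub_re]
  have hb : |((ρ H - 1) * ρ k').trace.re| ≤ Real.sqrt N * ‖ρ H - 1‖ := by
    refine (abs_re_trace_le_sqrt_mul _).trans ?_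
    rw [Matrix.frobenius_norm_mul_unitaryGroup _ ⟨ρ k', hρu k'⟩]
  rw [← sub_div, ← hr, hdiff, abs_div, abs_of_pos hN0, div_le_div_iff₀ hN0 hsq]
  calc |((ρ H - 1) * ρ k').trace.re| * Real.sqrt N ≤ Real.sqrt N * ‖ρ H - 1‖ * Real.sqrt N := by gcongr
    _ = ‖ρ H - 1‖ * N := by rw [mul_comm (Real.sqrt N), mul_assoc, Real.mul_self_sqrt hN0.le]

/-- `clip r` sits at most `2|t − r|/(1 − r)` above its twisted value `−1`. -/
theorem clip_le_neg_one_add {r : ℝ} (hr : r < 1) (t : ℝ) : clip r t ≤ -1 + 2 * |t - r| / (1 - r) := by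
  have h1r : 0 < 1 - r := by linarith
  have habs : 0 ≤ 2 * |t - r| / (1 - r) := by positivity
  unfold clip
  refine max_le (by linarith) ((min_le_right _ _).trans ?_)
  have : 2 * (t - r) / (1 - r) ≤ 2 * |t - r| / (1 - r) := by
    gcongr; exact le_abs_self _
  linarith

/-- **STEP (3) of the F_poly plan, pointwise and deterministic (PROVED).**  For unitary `ρ`, `N ≥ 1`, a twist `k₀` with
`r = Re χ_ρ(k₀)/N < 1`, any `H` (the physical rectangle holonomy in the un-twisted gauge) and any conjugator `g`:
`clip r (Re tr ρ(H · g k₀⁻¹ g⁻¹)/N) ≤ −1 + (2/((1−r)√N)) ‖ρ(H) − 1‖_F`.  (GEN 6's zero-temperature identity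
`chargedTest_re_eq_of_minimiser_comb` is the case `ρ(H) = 1`.) -/
theorem clip_re_trace_twisted_le (hρu : ∀ g, ρ g ∈ Matrix.unitaryGroup (Fin N) ℂ) (hN : 1 ≤ N) {k₀ : G}
    (hr : (ρ k₀).trace.re / N < 1) (H g : G) :
    clip ((ρ k₀).trace.re / N) ((ρ (H * (g * k₀⁻¹ * g⁻¹))).trace.re / N) ≤
      -1 + 2 / ((1 - (ρ k₀).trace.re / N) * Real.sqrt N) * ‖ρ H - 1‖ := by
  have hN0 : (0 : ℝ) < N := by exact_mod_cast hN
  have hsq : 0 < Real.sqrt N := Real.sqrt_pos.2 hN0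
  have h1r : 0 < 1 - (ρ k₀).trace.re / N := by linarith
  have hne : (N : ℝ) - (ρ k₀).trace.re ≠ 0 := by
    intro h0
    have : 1 - (ρ k₀).trace.re / N = ((N : ℝ) - (ρ k₀).trace.re) / N := by field_simp
    rw [this, h0, zero_div] at h1r
    exact lt_irrefl _ h1r
  refine (clip_le_neg_one_add hr _).trans ?_
  have hdev := abs_re_trace_mul_conj_sub_le ρ hρu hN H g k₀
  have : 2 * |(ρ (H * (g * k₀⁻¹ * g⁻¹))).trace.re / N - (ρ k₀).trace.re / N| / (1 - (ρ k₀).trace.re / N) ≤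
      2 / ((1 - (ρ k₀).trace.re / N) * Real.sqrt N) * ‖ρ H - 1‖ := by
    rw [div_le_iff₀ h1r]
    calc 2 * |(ρ (H * (g * k₀⁻¹ * g⁻¹))).trace.re / N - (ρ k₀).trace.re / N|
        ≤ 2 * (‖ρ H - 1‖ / Real.sqrt N) := by gcongr
      _ = 2 / ((1 - (ρ k₀).trace.re / N) * Real.sqrt N) * ‖ρ H - 1‖ * (1 - (ρ k₀).trace.re / N) := by
          field_simp
  linarith

end ClipAlgebra

end Summit.QuantumFields.YangMills.Cruxes.IR.RowFloorPoly

end
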